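import Summits.KontsevichZagierPeriods.Zeta5Search.Certificates.RecordRayStepTailTable
import HarnessLib

/-!
# ζ(5) search — the record ray's DENOMINATORS, XI-g: class-law windows at ANY SHIFT `m = ⌊n/p⌋ ≥ 1` (`n/(m+1) < p < n/m`, `p ∤ n`) (p3 g7)

HONEST FRAMING: systematic search; no irrationality claim unless certified.

OUR work (Summit side; prover seat p3, generation 7).  File XI-f (`BWin.okClassH`, source kind `4`) consumes class-law windows
`cw : List CWin` below `θ = p/n = 1` only on `(1/2, 1)` (`a₂ ≤ 2a₁`, `b₁ < b₂`), where no window prime divides `n`.  The same holds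
at EVERY shift: a table window inside `(1/(m+1), 1/m)` (integer form `a₂ ≤ (m+1)·a₁`, `m·b₁ < b₂`, the shift kept in the row's field
`m`) has `m·p < n < (m+1)·p`, so `p ∤ n` (`not_dvd_of_shift_window`), and the partner normaliser `N♯(b′)` is read through
`padicValRat_sharpNormaliser_bRecord'_of_not_dvd` exactly as in XI-f.  This file adds
* source kind `5` (`BWin.okClassK`: shift-`m` shape + containment in a class-law window of `cw` + the twelve pinned integer parts
  + the two exponent caps), its soundness `sound_of_okClassK` (`cell_core`), the extended check `ok5 cw = ok4 cw ∨ (okShape ∧ okClassK cw)`,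
  `soundList_of_all_ok5`, `all_ok5_of_all_ok4`;
* the table theorems `record_exponent_of_table5` (multiplier `ML`) and `record_exponent_of_table5_tail` (multiplier `MLT`, the uniform
  brick tail of files XIII/XIII-b).
So the census by-name LETTERS windows of the record ray at shifts `m = 2 … 15` (`θ ∈ (1/16, 1/2)`; census g37: 0.39 nats at
`m = 2 … 7`) become table rows as soon as their `CWin.Holds` theorems exist (kit rows or faces) — no further consumer work.
Valuation bookkeeping; every `γ < 1` — no irrationality content.
-/

noncomputable section

open Finset Real Filter Topology

namespace Summit.KontsevichZagierPeriods.Zeta5Search.RecordRay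

open Summit.KontsevichZagierPeriods.Zeta5Search.DualSeries
open Summit.KontsevichZagierPeriods.Zeta5Search.DualSeriesDenominators
open Summit.KontsevichZagierPeriods.Zeta5Search.WedgeDictionary
open Summit.KontsevichZagierPeriods.Zeta5Search.DualSeriesLemma19 (bRecord)
open Summit.KontsevichZagierPeriods.Zeta5Search.CasoratianValuation (casoratian shift)
open Summit.KontsevichZagierPeriods.Zeta5Search.ClusterValuation (bRec)
open Literature.NumberTheory.Transcendental (zetaValue)

/-- A prime of a window inside `(n/(m+1), n/m)` (integer form: `a₁n < a₂p`, `b₂p ≤ b₁n`, `a₂ ≤ (m+1)a₁`, `m·b₁ < b₂`, `1 ≤ m`) does not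
divide `n ≥ 1`: `n = p·q` would force `m < q < m + 1`. -/
theorem not_dvd_of_shift_window {n p a₁ a₂ b₁ b₂ m : ℕ} (hp : p.Prime) (hn : 1 ≤ n) (hlo : a₁ * n < a₂ * p) (hhi : b₂ * p ≤ b₁ * n)
    (ha : a₂ ≤ (m + 1) * a₁) (hb : m * b₁ < b₂) : ¬ p ∣ n := by
  rintro ⟨q, rfl⟩
  have hp0 := hp.pos
  have h1 : a₁ * q < a₂ := by
    have : p * (a₁ * q) < p * a₂ := by
      calc p * (a₁ * q) = a₁ * (p * q) := by ring
        _ < a₂ * p := hlo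
        _ = p * a₂ := by ring
    exact Nat.lt_of_mul_lt_mul_left this
  have h2 : b₂ ≤ b₁ * q := by
    have : p * b₂ ≤ p * (b₁ * q) := by
      calc p * b₂ = b₂ * p := by ring
        _ ≤ b₁ * (p * q) := hhi
        _ = p * (b₁ * q) := by ring
    exact Nat.le_of_mul_le_mul_left this hp0
  rcases Nat.lt_or_ge q (m + 1) with hq | hq
  · -- q ≤ m: b₂ ≤ b₁ q ≤ m b₁ < b₂
    have : b₁ * q ≤ b₁ * m := Nat.mul_le_mul_left _ (by omega)
    have : m * b₁ = b₁ * m := by ring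
    omega
  · -- q ≥ m+1: a₂ ≤ (m+1) a₁ ≤ a₁ q < a₂
    have : a₁ * (m + 1) ≤ a₁ * q := Nat.mul_le_mul_left _ hq
    have : (m + 1) * a₁ = a₁ * (m + 1) := by ring
    omega

namespace BWin

/-- Source check, kind `5`: as kinds `3`/`4` but for a table window inside `(1/(m+1), 1/m)` for the shift `m = w.m ≥ 1`
(`a₂ ≤ (m+1)a₁`, `m·b₁ < b₂`; class-law window with `a₂ᶜ ≤ (m+1)a₁ᶜ`, `0 < b₁ᶜ`, `(m+1)·b₁ᶜ < 10496`). -/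
def okClassK (cw : List CWin) (w : BWin) : Bool :=
  (w.kind == 5) && decide (1 ≤ w.m) && decide (w.a2 ≤ (w.m + 1) * w.a1) && decide (w.m * w.b1 < w.b2) &&
    match cw[w.idx]? with
    | some c =>
        decide (0 < c.a2) && decide (c.a2 ≤ (w.m + 1) * c.a1) && decide (0 < c.b1) && decide ((w.m + 1) * c.b1 < 10496) &&
          decide (c.N0 ≤ 10496) &&
          decide (c.a1 * w.a2 ≤ w.a1 * c.a2) && decide (w.b1 * c.b2 ≤ c.b1 * w.b2) &&
          (w.okFloor 8 && w.okFloor 9 && w.okFloor 10 && w.okFloor 11 && w.okFloor 12 && w.okFloor 13 && w.okFloor 14 &&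
            w.okFloor 15 && w.okFloor 16 && w.okFloor 17 && w.okFloor 18 && w.okFloor 25) &&
          decide ((w.k : ℤ) ≤ 9 + w.vN + w.vN + c.B) && decide ((w.k : ℤ) ≤ 9 + w.vN + w.vN - w.vrho)
    | none => false

/-- The extended check: `ok4` (kinds 0–4) or a shape-checked class-law window at any shift (kind 5). -/
def ok5 (cw : List CWin) (w : BWin) : Bool := w.ok4 cw || (w.okShape && w.okClassK cw)

section Sound

variable {n p : ℕ}

/-- **Soundness, kind `5`**: a prime of a window inside a class-law window at shift `m` (`n/(m+1) < p < n/m`) gets `p^k` through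
`cell_core`. -/
theorem sound_of_okClassK {cw : List CWin} (hcw : ∀ c ∈ cw, c.Holds) {w : BWin} (hs : w.okShape = true)
    (h : w.okClassK cw = true) : w.Sound := by
  intro n p hn hp hlo hhi zW zV zW' zV' zU zU' hzW hzV hzW' hzV' hzU hzU'
  have hs' := hs
  simp only [okClassK, Bool.and_eq_true, beq_iff_eq, decide_eq_true_eq] at h
  obtain ⟨⟨⟨⟨-, hm1⟩, hwa⟩, hwb⟩, h⟩ := h
  split at h
  · rename_i c hc
    simp only [Bool.and_eq_true, decide_eq_true_eq] at h
    obtain ⟨⟨⟨⟨⟨⟨⟨⟨⟨hca2, hcaa⟩, hb1pos⟩, hcb1⟩, hcN⟩, hL⟩, hR⟩, hF⟩, hk1⟩, hk2⟩ := h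
    obtain ⟨⟨⟨⟨⟨⟨⟨⟨⟨⟨⟨f8, f9⟩, f10⟩, f11⟩, f12⟩, f13⟩, f14⟩, f15⟩, f16⟩, f17⟩, f18⟩, f25⟩ := hF
    simp only [okShape, Bool.and_eq_true, decide_eq_true_eq] at hs
    obtain ⟨⟨⟨⟨⟨ha1, ha2⟩, hb2⟩, hab⟩, h16⟩, h41⟩ := hs
    have hcmem : c ∈ cw := List.mem_iff_getElem?.mpr ⟨w.idx, hc⟩
    have hn1 : 1 ≤ n := by omega
    have hnd : ¬ p ∣ n := not_dvd_of_shift_window hp hn1 hlo hhi hwa hwb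
    have hclo : c.a1 * n < c.a2 * p := by
      have h3 : w.a2 * (c.a1 * n) < w.a2 * (c.a2 * p) := by
        calc w.a2 * (c.a1 * n) = (c.a1 * w.a2) * n := by ring
          _ ≤ (w.a1 * c.a2) * n := Nat.mul_le_mul_right n hL
          _ = c.a2 * (w.a1 * n) := by ring
          _ < c.a2 * (w.a2 * p) := Nat.mul_lt_mul_of_pos_left hlo hca2
          _ = w.a2 * (c.a2 * p) := by ring
      exact Nat.lt_of_mul_lt_mul_left h3
    -- n < (m+1) p from the class window's left end, hence p > c.b₁ and 16 p > n
    have hnmp : n < (w.m + 1) * p := by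
      have h2 : c.a2 * n < c.a2 * ((w.m + 1) * p) :=
        calc c.a2 * n ≤ ((w.m + 1) * c.a1) * n := Nat.mul_le_mul_right n hcaa
          _ = (w.m + 1) * (c.a1 * n) := by ring
          _ < (w.m + 1) * (c.a2 * p) := Nat.mul_lt_mul_of_pos_left hclo (by omega)
          _ = c.a2 * ((w.m + 1) * p) := by ring
      exact Nat.lt_of_mul_lt_mul_left h2
    have hpcb : c.b1 < p := by
      by_contra hcon
      have hpc : p ≤ c.b1 := not_lt.1 hcon
      have : (w.m + 1) * p ≤ (w.m + 1) * c.b1 := Nat.mul_le_mul_left _ hpc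
      omega
    have hchi : c.b2 * p < c.b1 * n := by
      have h2 : w.b2 * (c.b2 * p) ≤ w.b2 * (c.b1 * n) := by
        calc w.b2 * (c.b2 * p) = c.b2 * (w.b2 * p) := by ring
          _ ≤ c.b2 * (w.b1 * n) := Nat.mul_le_mul_left _ hhi
          _ = (w.b1 * c.b2) * n := by ring
          _ ≤ (c.b1 * w.b2) * n := Nat.mul_le_mul_right n hR
          _ = w.b2 * (c.b1 * n) := by ring
      have hle : c.b2 * p ≤ c.b1 * n := Nat.le_of_mul_le_mul_left h2 hb2
      rcases hle.lt_or_eq with hlt | heq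
      · exact hlt
      · exfalso
        have hdvd : p ∣ c.b1 * n := ⟨c.b2, by rw [← heq]; ring⟩
        rcases (Nat.Prime.dvd_mul hp).1 hdvd with h1 | h1
        · exact absurd (Nat.le_of_dvd hb1pos h1) (by omega)
        · exact hnd h1
    have hp41 : p ≤ 41 * n := by
      have h2 : w.b2 * p ≤ w.b2 * (41 * n) :=
        calc w.b2 * p ≤ w.b1 * n := hhi
          _ ≤ (41 * w.b2) * n := Nat.mul_le_mul_right n h41
          _ = w.b2 * (41 * n) := by ring
      exact Nat.le_of_mul_le_mul_left h2 hb2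
    -- p > n/16 (table shape `a₂ ≤ 16a₁`) and n ≥ 10496 = 41·256 ⇒ p ≥ 657, p² > 41n + 2
    have hn16p : n < 16 * p := by
      have h2 : w.a1 * n < w.a1 * (16 * p) :=
        calc w.a1 * n < w.a2 * p := hlo
          _ ≤ (16 * w.a1) * p := Nat.mul_le_mul_right p h16
          _ = w.a1 * (16 * p) := by ring
      exact Nat.lt_of_mul_lt_mul_left h2
    have hp657 : 657 ≤ p := by omega
    have hsq2 : 41 * n + 2 < p ^ 2 :=
      calc 41 * n + 2 < 657 * p := by omega
        _ ≤ p * p := Nat.mul_le_mul_right p hp657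
        _ = p ^ 2 := (sq p).symm
    have hsq : 41 * n < p ^ 2 := by omega
    have hp14 : 14 < p := by omega
    have hp2 : p ≠ 2 := by omega
    have e8 := fl_eq hs' f8 hlo hhi
    have e9 := fl_eq hs' f9 hlo hhi
    have e10 := fl_eq hs' f10 hlo hhi
    have e11 := fl_eq hs' f11 hlo hhi
    have e12 := fl_eq hs' f12 hlo hhi
    have e13 := fl_eq hs' f13 hlo hhi
    have e14 := fl_eq hs' f14 hlo hhi
    have e15 := fl_eq hs' f15 hlo hhi
    have e16 := fl_eq hs' f16 hlo hhi
    have e17 := fl_eq hs' f17 hlo hhi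
    have e18 := fl_eq hs' f18 hlo hhi
    have e25 := fl_eq hs' f25 hlo hhi
    have hvN : padicValRat p (sharpNormaliser (bRecord n)) = w.vN := by
      rw [padicValRat_sharpNormaliser_bRecord hp (by omega), e12, e13, e14, e15, e16]; rfl
    have hvN' : padicValRat p (sharpNormaliser (bRecord' n)) = w.vN := by
      rw [padicValRat_sharpNormaliser_bRecord'_of_not_dvd hn1 hp hnd hp14 (by omega), e12, e13, e14, e15, e16]; rfl
    have hvr : padicValRat p (rhoOf (aRec n)) = w.vrho := by
      rw [padicValRat_rhoOf_aRec hp hp2 (by omega), e8, e9, e10, e11, e12, e13, e14, e15, e16, e17, e18, e25]; rfl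
    have hcas : casoratian (bRecord n) 7 ≠ 0 → c.B ≤ padicValRat p (casoratian (bRecord n) 7) := by
      intro hne
      rw [bRecord_eq_bRec] at hne ⊢
      exact hcw c hcmem n p (by omega) hp hclo hchi hsq2 hne
    exact cell_core hn1 hp hp41 hsq hvN hvN' hvr hcas (k := w.k) (by linarith) (by linarith) hzW hzV hzW' hzV' hzU hzU'
  · exact absurd h Bool.false_ne_true

/-- `ok5 ⇒ okShape`. -/
theorem okShape_of_ok5 {cw : List CWin} {w : BWin} (h : w.ok5 cw = true) : w.okShape = true := by
  simp only [ok5, Bool.or_eq_true, Bool.and_eq_true] at h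
  rcases h with h | ⟨hs, -⟩
  · exact okShape_of_ok4 h
  · exact hs

/-- `ok5 ⇒ Sound` (given the class-law windows). -/
theorem sound_of_ok5 {cw : List CWin} (hcw : ∀ c ∈ cw, c.Holds) {w : BWin} (h : w.ok5 cw = true) : w.Sound := by
  have h' := h
  simp only [ok5, Bool.or_eq_true, Bool.and_eq_true] at h'
  rcases h' with h1 | ⟨hs, hl⟩
  · exact sound_of_ok4 hcw h1
  · exact sound_of_okClassK hcw hs hl

end Sound

end BWin

namespace BrickAtlas

variable {l : List BWin}

/-- A list checked by `ok5` is sound (given the class-law windows). -/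
theorem soundList_of_all_ok5 {cw : List CWin} (hcw : ∀ c ∈ cw, c.Holds) (hok : l.all (BWin.ok5 cw) = true) :
    SoundList l := fun i =>
  have h := List.all_eq_true.1 hok _ (List.getElem_mem i.isLt)
  ⟨BWin.okShape_of_ok5 h, BWin.sound_of_ok5 hcw h⟩

/-- `ok4`-checked lists are `ok5`-checked. -/
theorem all_ok5_of_all_ok4 {cw : List CWin} (hok : l.all (BWin.ok4 cw) = true) : l.all (BWin.ok5 cw) = true := by
  rw [List.all_eq_true] at hok ⊢
  intro w hw
  have := hok w hw
  simp only [BWin.ok5, Bool.or_eq_true]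
  exact Or.inl this

/-- `ok`-checked lists are `ok5`-checked. -/
theorem all_ok5_of_all_ok (cw : List CWin) (hok : l.all BWin.ok = true) : l.all (BWin.ok5 cw) = true :=
  all_ok5_of_all_ok4 (all_ok4_of_all_ok cw hok)

/-- `ok2`-checked lists are `ok5`-checked. -/
theorem all_ok5_of_all_ok2 (cw : List CWin) (hok : l.all BWin.ok2 = true) : l.all (BWin.ok5 cw) = true :=
  all_ok5_of_all_ok4 (all_ok4_of_all_ok2 cw hok)

/-- **The exponent of a table checked by `ok5`** (multiplier `ML`). -/
theorem record_exponent_of_table5 {cw : List CWin} (hcw : ∀ c ∈ cw, c.Holds) (hok : l.all (BWin.ok5 cw) = true)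
    (hch : chainSep l = true) {γ : ℝ} (hγ0 : 0 ≤ γ)
    (hγ : γ * ((((3815232 / 10000 - rateQ l : ℚ) : ℝ) + 2 / 100) + 8508768884 / 10 ^ 8) <
      8508768883 / 10 ^ 8 + 315452 / 10000) :
    ∀ᶠ n : ℕ in atTop, ∃ p : ℤ, ∃ q : ℕ, 1 ≤ q ∧ (q : ℚ) = ML l n * |(recordQ n : ℚ)| ∧ (p : ℚ) = ML l n * recordP n ∧
      |zetaValue 5 - (recordP n : ℝ) / (recordQ n : ℝ)| < 1 / (q : ℝ) ^ γ :=
  record_exponent_of_sound (soundList_of_all_ok5 hcw hok) hch hγ0 hγ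

/-- **The exponent of a table checked by `ok5`, WITH THE UNIFORM BRICK TAIL** (multiplier `MLT = ML / tailFactor`, rate
`381.5232 − rateQ l − 0.3046`). -/
theorem record_exponent_of_table5_tail {cw : List CWin} (hcw : ∀ c ∈ cw, c.Holds) (hok : l.all (BWin.ok5 cw) = true)
    (hch : chainSep l = true) {γ : ℝ} (hγ0 : 0 ≤ γ)
    (hγ : γ * ((((3815232 / 10000 - rateQ l - 3046 / 10000 : ℚ) : ℝ) + 2 / 100) + 8508768884 / 10 ^ 8) <
      8508768883 / 10 ^ 8 + 315452 / 10000) :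
    ∀ᶠ n : ℕ in atTop, ∃ p : ℤ, ∃ q : ℕ, 1 ≤ q ∧ (q : ℚ) = MLT l n * |(recordQ n : ℚ)| ∧ (p : ℚ) = MLT l n * recordP n ∧
      |zetaValue 5 - (recordP n : ℝ) / (recordQ n : ℝ)| < 1 / (q : ℝ) ^ γ :=
  record_exponent_of_sound_tail (soundList_of_all_ok5 hcw hok) hch hγ0 hγ

end BrickAtlas

end Summit.KontsevichZagierPeriods.Zeta5Search.RecordRay
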